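import Mathlib.Probability.Kernel.Condexp
import Mathlib.Probability.Kernel.CompProdEqIff
import Literature.Probability.LatticeModels.GibbsTailConditioning
import HarnessLib

/-!
# Disintegration of a Gibbs measure along the tail σ-algebra

Topic `Probability/LatticeModels`, generic specifications `γ : Specification V S` on a countable
site set with a standard Borel single-spin space (so that the configuration space `V → S` is
standard Borel and Mathlib's regular conditional probability kernel `condExpKernel` exists).
Second infrastructure file toward the Aizenman–Higuchi theorem along Georgii–Higuchi 2000, whose
§2 (p. 3 of arXiv:math/9907186) uses "the extremal decomposition representing any Gibbs measure
as the barycenter of a mass distribution on ex 𝒢" (Georgii 2011, Thm. 7.26). This file proves the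
kernel half of that decomposition for the conditional probability kernel
`π = condExpKernel μ 𝒯` of a Gibbs measure `μ` given the tail σ-algebra `𝒯 = tailEvents V S`:

* `setLIntegral_condExpKernel_tail` — `∫_B π(·)(C) dμ = μ(B ∩ C)` for `B ∈ 𝒯`;
  `bind_condExpKernel_tail` — the barycentre formula `μ = ∫ π^ω μ(dω)` (`μ.bind π = μ`), and its
  restricted form `restrict_bind_condExpKernel_tail`;
* `setLIntegral_lintegral_condExpKernel_tail` — `∫_B π(g) dμ = ∫_B g dμ` for `B ∈ 𝒯`, `g ≥ 0`;
* `condExpKernel_tail_apply_ae_eq_indicator` — `π^ω(B) = 1_B(ω)` a.s. for `B ∈ 𝒯`;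
* `IsGibbsMeasure.ae_bind_condExpKernel_tail_eq` and
  **`IsGibbsMeasure.ae_isGibbsMeasure_condExpKernel_tail`** — for `μ ∈ 𝒢(γ)`, `μ`-almost every
  conditional measure `π^ω` is itself a Gibbs measure for `γ` (Georgii 2011, Thm. 7.26 with
  Prop. 7.22/7.25, the step "`π(·|ω) ∈ 𝒢(γ)`"). Proof: for `B ∈ 𝒯 ⊆ 𝓕_{Λᶜ}` and measurable `A`,
  `∫_B (π^ω γ_Λ)(A) μ(dω) = ∫_B γ_Λ(A|·) dμ = ∫ γ_Λ(A ∩ B|·) dμ = μ(A ∩ B) = ∫_B π^ω(A) μ(dω)`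
  (tower property of `π`, properness, DLR), i.e. the kernels `γ_Λ ∘ π` and `π` have the same
  composition-product with `μ|_𝒯`; by Mathlib's `Kernel.ae_eq_of_compProd_eq` (target countably
  generated) they agree `μ`-a.e., simultaneously for the countably many finite `Λ`.

Almost-sure tail triviality of `π^ω` (the other half of Thm. 7.26) is not in this file.

## Mathlib

`ProbabilityTheory.condExpKernel`, `compProd_trim_condExpKernel`, `Measure.compProd_apply_prod`,
`Measure.ext_prod`, `Kernel.ae_eq_of_compProd_eq`, `setLIntegral_trim`, `Measure.lintegral_bind`.
No Gibbs measures / extremal decomposition in Mathlib.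

## References

* H.-O. Georgii, *Gibbs Measures and Phase Transitions*, 2nd ed., de Gruyter 2011, §7.3,
  Prop. 7.22, Prop. 7.25, Thm. 7.26 [Georgii2011].
* H.-O. Georgii, Y. Higuchi, J. Math. Phys. 41 (2000) 1153–1169, §2, p. 3 [GeorgiiHiguchi2000].
-/

noncomputable section

open MeasureTheory ProbabilityTheory
open scoped ENNReal ProbabilityTheory

namespace Literature.Probability.LatticeModels

variable {V S : Type*} [MeasurableSpace S] [Countable V] [StandardBorelSpace S]

/-! ### The conditional kernel given the tail σ-algebra: integration identities -/

section Kernel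

variable (μ : Measure (V → S)) [IsFiniteMeasure μ]

/-- **Defining identity of the tail kernel on rectangles**: for `B ∈ 𝒯` and measurable `C`,
`∫_B π^ω(C) μ(dω) = μ(B ∩ C)` where `π = condExpKernel μ 𝒯` (Georgii 2011, Prop. 7.22 (ii):
`π(C|·) = μ(C|𝒯)` a.s.; here from Mathlib's `compProd_trim_condExpKernel`). [cite: Georgii2011, Prop. 7.22] -/
theorem setLIntegral_condExpKernel_tail {B C : Set (V → S)}
    (hB : MeasurableSet[tailEvents V S] B) (hC : MeasurableSet C) :
    ∫⁻ ω in B, condExpKernel μ (tailEvents V S) ω C ∂μ = μ (B ∩ C) := by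
  have hm : tailEvents V S ≤ (MeasurableSpace.pi : MeasurableSpace (V → S)) := tailEvents_le_pi
  have key := compProd_trim_condExpKernel (μ := μ) (m := tailEvents V S) hm
  have hrect := Measure.compProd_apply_prod (μ := μ.trim hm)
    (κ := condExpKernel μ (tailEvents V S)) hB hC
  have hdiag : @Measurable (V → S) ((V → S) × (V → S)) MeasurableSpace.pi
      ((tailEvents V S).prod MeasurableSpace.pi) (fun ω => (id ω, id ω)) :=
    (measurable_id.mono le_rfl hm).prodMk measurable_id
  rw [← setLIntegral_trim hm (measurable_condExpKernel hC) hB, ← hrect, key,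
    Measure.map_apply hdiag (hB.prod hC)]
  rfl

/-- **Barycentre formula, restricted to a tail event**: `(μ|_B) π = μ|_B` for `B ∈ 𝒯`, i.e.
`∫_B π^ω(·) μ(dω) = μ(· ∩ B)` (Georgii 2011, Prop. 7.22 / (7.20)). [cite: Georgii2011, Prop. 7.22] -/
theorem restrict_bind_condExpKernel_tail {B : Set (V → S)}
    (hB : MeasurableSet[tailEvents V S] B) :
    (μ.restrict B).bind (condExpKernel μ (tailEvents V S)) = μ.restrict B := by
  have hm : tailEvents V S ≤ (MeasurableSpace.pi : MeasurableSpace (V → S)) := tailEvents_le_pi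
  have hmeas : Measurable (condExpKernel μ (tailEvents V S) : (V → S) → Measure (V → S)) :=
    (condExpKernel μ (tailEvents V S)).measurable.mono hm le_rfl
  ext C hC
  rw [Measure.bind_apply hC hmeas.aemeasurable, setLIntegral_condExpKernel_tail μ hB hC,
    Measure.restrict_apply hC, Set.inter_comm]

/-- **Barycentre formula** `μ = ∫ π^ω μ(dω)`, i.e. `μ π = μ` for the tail kernel
`π = condExpKernel μ 𝒯` (Georgii 2011, Prop. 7.22 (i) / Thm. 7.26). [cite: Georgii2011, Thm. 7.26] -/
theorem bind_condExpKernel_tail : μ.bind (condExpKernel μ (tailEvents V S)) = μ := by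
  have h := restrict_bind_condExpKernel_tail μ (B := Set.univ)
    (@MeasurableSet.univ _ (tailEvents V S))
  rwa [Measure.restrict_univ] at h

/-- **Tower property of the tail kernel in integrated form**: for `B ∈ 𝒯` and measurable
`g ≥ 0`, `∫_B (∫ g dπ^ω) μ(dω) = ∫_B g dμ` (Georgii 2011, Prop. 7.22 (ii)). [cite: Georgii2011, Prop. 7.22] -/
theorem setLIntegral_lintegral_condExpKernel_tail {g : (V → S) → ℝ≥0∞} (hg : Measurable g)
    {B : Set (V → S)} (hB : MeasurableSet[tailEvents V S] B) :
    ∫⁻ ω in B, ∫⁻ ω', g ω' ∂(condExpKernel μ (tailEvents V S) ω) ∂μ = ∫⁻ ω in B, g ω ∂μ := by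
  have hm : tailEvents V S ≤ (MeasurableSpace.pi : MeasurableSpace (V → S)) := tailEvents_le_pi
  have hmeas : Measurable (condExpKernel μ (tailEvents V S) : (V → S) → Measure (V → S)) :=
    (condExpKernel μ (tailEvents V S)).measurable.mono hm le_rfl
  rw [← Measure.lintegral_bind hmeas.aemeasurable hg.aemeasurable,
    restrict_bind_condExpKernel_tail μ hB]

/-- **The tail kernel is `0`–`1` on each tail event**: for `B ∈ 𝒯`, `π^ω(B) = 1_B(ω)` for
`μ`-a.e. `ω` (Georgii 2011, Prop. 7.25, the identity `π(B|·) = 1_B` a.s. for `B ∈ 𝒯`). [cite: Georgii2011, Prop. 7.25] -/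
theorem condExpKernel_tail_apply_ae_eq_indicator {B : Set (V → S)}
    (hB : MeasurableSet[tailEvents V S] B) :
    ∀ᵐ ω ∂μ, condExpKernel μ (tailEvents V S) ω B = B.indicator 1 ω := by
  have hm : tailEvents V S ≤ (MeasurableSpace.pi : MeasurableSpace (V → S)) := tailEvents_le_pi
  have hBm : MeasurableSet B := hm _ hB
  have hBc : MeasurableSet[tailEvents V S] Bᶜ := hB.compl
  -- on `B`, `π^ω(Bᶜ) = 0` a.e.; on `Bᶜ`, `π^ω(B) = 0` a.e.
  have h1 : ∀ᵐ ω ∂μ, ω ∈ B → condExpKernel μ (tailEvents V S) ω Bᶜ = 0 := by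
    rw [← ae_restrict_iff' hBm]
    refine (lintegral_eq_zero_iff ((measurable_condExpKernel hBm.compl).mono hm le_rfl)).1 ?_
    rw [setLIntegral_condExpKernel_tail μ hB hBm.compl, Set.inter_compl_self, measure_empty]
  have h2 : ∀ᵐ ω ∂μ, ω ∈ Bᶜ → condExpKernel μ (tailEvents V S) ω B = 0 := by
    rw [← ae_restrict_iff' hBm.compl]
    refine (lintegral_eq_zero_iff ((measurable_condExpKernel hBm).mono hm le_rfl)).1 ?_
    rw [setLIntegral_condExpKernel_tail μ hBc hBm, Set.compl_inter_self, measure_empty]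
  filter_upwards [h1, h2] with ω hω1 hω2
  by_cases hω : ω ∈ B
  · rw [Set.indicator_of_mem hω, Pi.one_apply, ← prob_compl_eq_zero_iff hBm]
    exact hω1 hω
  · rw [Set.indicator_of_notMem hω]
    exact hω2 hω

end Kernel

/-! ### Almost every conditional measure of a Gibbs measure is a Gibbs measure -/

section Gibbs

variable {γ : Specification V S} {μ : Measure (V → S)} [IsFiniteMeasure μ]

/-- **The tail kernel of a Gibbs measure is `γ_Λ`-invariant almost surely**: for `μ ∈ 𝒢(γ)`
and every finite `Λ`, `π^ω γ_Λ = π^ω` for `μ`-a.e. `ω` (Georgii 2011, proof of Prop. 7.25 /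
Thm. 7.26: `π(·|ω) ∈ 𝒢(γ)`). Both kernels `γ_Λ ∘ π` and `π` have the same composition-product
with `μ|_𝒯` — on a rectangle `B × A`, `B ∈ 𝒯`, both give `μ(A ∩ B)` by the tower property,
properness (`B ∈ 𝓕_{Λᶜ}`) and the DLR equation — so they agree a.e.
(`Kernel.ae_eq_of_compProd_eq`). [cite: Georgii2011, Thm. 7.26] -/
theorem IsGibbsMeasure.ae_bind_condExpKernel_tail_eq (hγ : IsSpecification γ)
    (hμ : IsGibbsMeasure γ μ) (Λ : Finset V) :
    ∀ᵐ ω ∂μ, (condExpKernel μ (tailEvents V S) ω).bind (γ Λ) =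
      condExpKernel μ (tailEvents V S) ω := by
  have hm : tailEvents V S ≤ (MeasurableSpace.pi : MeasurableSpace (V → S)) := tailEvents_le_pi
  -- `γ_Λ` as a Markov kernel on the full σ-algebra
  let κ : Kernel (V → S) (V → S) := ⟨γ Λ, hγ.measurable_fun Λ⟩
  haveI : IsMarkovKernel κ := ⟨fun η => hγ.isProbability Λ η⟩
  set π := condExpKernel μ (tailEvents V S) with hπ
  -- the two composition-products agree on rectangles
  have hcomp : (μ.trim hm) ⊗ₘ (κ ∘ₖ π) = (μ.trim hm) ⊗ₘ π := by
    refine Measure.ext_prod fun {B} {A} hB hA => ?_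
    rw [Measure.compProd_apply_prod hB hA, Measure.compProd_apply_prod hB hA,
      setLIntegral_trim hm ((κ ∘ₖ π).measurable_coe hA) hB,
      setLIntegral_trim hm (π.measurable_coe hA) hB, setLIntegral_condExpKernel_tail μ hB hA]
    simp_rw [Kernel.comp_apply' _ _ _ hA]
    change ∫⁻ ω in B, ∫⁻ ω', γ Λ ω' A ∂(π ω) ∂μ = μ (B ∩ A)
    rw [setLIntegral_lintegral_condExpKernel_tail μ (hγ.measurable_coe Λ hA) hB]
    -- `∫_B γ_Λ(A|·) dμ = ∫ γ_Λ(A ∩ B|·) dμ = μ(A ∩ B)` (properness and DLR)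
    have hBΛ : MeasurableSet[cylinderEvents (X := fun _ : V => S) ((↑Λ : Set V)ᶜ)] B :=
      tailEvents_le_cylinderEvents Λ _ hB
    have hBm : MeasurableSet B := hm _ hB
    have hind : ∀ η, B.indicator (fun η => γ Λ η A) η = γ Λ η (A ∩ B) := by
      intro η
      rw [hγ.measure_inter_of_cylinderEvents Λ A hBΛ η]
      by_cases hη : η ∈ B
      · simp [Set.indicator_of_mem hη]
      · simp [Set.indicator_of_notMem hη]
    rw [← lintegral_indicator hBm]
    simp_rw [hind]
    rw [hμ.2 Λ (A ∩ B) (hA.inter hBm), Set.inter_comm]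
  have hae : (κ ∘ₖ π : (V → S) → Measure (V → S)) =ᵐ[μ.trim hm] π :=
    Kernel.ae_eq_of_compProd_eq hcomp
  filter_upwards [ae_of_ae_trim hm hae] with ω hω
  rw [Kernel.comp_apply] at hω
  exact hω

/-- **Almost every conditional measure of a Gibbs measure given the tail σ-algebra is a Gibbs
measure** (Georgii 2011, Thm. 7.26 with Prop. 7.22/7.25: `π(·|ω) ∈ 𝒢(γ)`; used by
Georgii–Higuchi 2000, §2, p. 3, "extremal decomposition"): for `μ ∈ 𝒢(γ)`,
`condExpKernel μ 𝒯 ω ∈ 𝒢(γ)` for `μ`-a.e. `ω` (the finite volumes `Λ` range over the countable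
type `Finset V`). [cite: Georgii2011, Thm. 7.26] -/
theorem IsGibbsMeasure.ae_isGibbsMeasure_condExpKernel_tail (hγ : IsSpecification γ)
    (hμ : IsGibbsMeasure γ μ) :
    ∀ᵐ ω ∂μ, IsGibbsMeasure γ (condExpKernel μ (tailEvents V S) ω) := by
  have hall : ∀ᵐ ω ∂μ, ∀ Λ : Finset V, (condExpKernel μ (tailEvents V S) ω).bind (γ Λ) =
      condExpKernel μ (tailEvents V S) ω :=
    ae_all_iff.2 fun Λ => hμ.ae_bind_condExpKernel_tail_eq hγ Λ
  filter_upwards [hall] with ω hω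
  refine ⟨inferInstance, fun Λ A hA => ?_⟩
  rw [← Measure.bind_apply hA (hγ.measurable_fun Λ).aemeasurable, hω Λ]

end Gibbs

end Literature.Probability.LatticeModels
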